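import Summits.QuantumAdvantage.QuantumAdvantage.Theorems.ArithStatLadderIqThreeNotPPoly
import Summits.QuantumAdvantage.QuantumAdvantage.Theorems.ArithStatLadderIqThreeNotBPPRURClosure
import Summits.QuantumAdvantage.QuantumAdvantage.Theorems.ArithStatLadderIqThreeNotBPPStubOrderThree
import Summits.QuantumAdvantage.QuantumAdvantage.Theorems.ArithStatLadderIqThreeNotBPPStubSamplerCubeFP
import Summits.QuantumAdvantage.QuantumAdvantage.Theorems.ArithStatLadderIqThreeNotBPPStubCubeDensity
import Summits.QuantumAdvantage.QuantumAdvantage.Theorems.ArithStatLadderIqThreeNotBPPStubCubeHit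

/-!
# Crux `ArithStatLadder.IqThreeNotBPP` (stmt-QuantumAdvantage-14864): UNIFORM SQUAREFREE-FILTER DOMINATION, class-field-theory-free

The conclusion of the line `Sketch` (lead `prover-line-stmt-QuantumAdvantage-14864-0`, skeleton v3):

* `toLanguage_squarefree_mem_BPP_of_iqThree` — **`IQ3 ∈ BPP → SQUAREFREES ∈ BPP`, UNCONDITIONALLY**
  (no named fact, no class field theory): the ONE-SIDED randomized polynomial-time reduction
  `SQF ≤ IQ3` by the Nagell-type planted family — on the numeral `N` (`n = |bin N|`) and the seed
  `j < 2^{6n+60}`: `M :=` the odd part (`N/2` resp. `N`), `U := 6M·2^{3n+32} ± 1`,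
  `s := 1 + 6MU·j`, output `0` if `4 ∣ N` else `4·M·s·(2U³ − M s)` (`stub_samplerCubeFP ∈ FP`,
  guarded by the landed `stub_natAdapter`); NO side exact (`planted_not_mem_of_not_squarefree`:
  `p² ∣ N ⇒ 4 ∣ N` or `p² ∣ M ∣ d/4`); YES side: `≥ 1/4` of the seeds have `s`, `2U³ − Ms`
  squarefree (the density stub, from the landed AP sieve), and then
  `m' = M s (2U³ − Ms) = U⁶ − (U³ − Ms)²` is squarefree `> U²`, so `−4m'` is fundamental and
  `3 ∣ h(−4m')` by the EXPLICIT order-3 ideal class `(U², (U³ − Ms) + √−m')`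
  (`stub_cubeHit ∘ stub_orderThreeCert`, Nagell 1922; `…StubOrderThree.lean`) — composed with the
  uniform closure of `BPP` under such reductions (`stub_rurClosureBPP` = `mem_BPP_of_rurReduction`,
  `…IqThreeNotBPPRURClosure.lean`);
* `iqThreeNotBPP_of_squarefree_not_mem_BPP` — **the crux `IqThreeNotBPP` follows from
  "SQUAREFREES ∉ BPP" ALONE** (hypothesis-type apex of the factoring family: Adleman–McCurley's
  open problem, uniform): a CONDITIONAL theorem about the route decl, by name, with a single
  hypothesis;
* `toLanguage_squarefree_mem_BPP_of_not_iqThreeNotBPP` — the refutation floor: any refutation of the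
  crux (a `BPP` algorithm for `3 ∣ h(−d)` on fundamental `−d`) puts SQUAREFREENESS TESTING in
  `BPP`, uniformly and unconditionally.

Theorems only; sorry-free; the only hypothesis anywhere is the explicit apex.
-/

set_option linter.dupNamespace false -- D-0017: single-problem summit ⇒ `QuantumAdvantage.QuantumAdvantage` by design

noncomputable section

namespace Summit.QuantumAdvantage.QuantumAdvantage.Theorems.IqThreeNotBPP

open scoped Classical
open _root_.Computability Polynomial Finset
open Literature.Computability.Complexity
open Literature.Computability.Cryptography (IsNegFundamentalDiscr)
open Literature.NumberTheory.QuadraticFields (BinaryQuadraticForm.classNumber)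
open Summit.QuantumAdvantage.QuantumAdvantage.Theses.ArithStatLadder (IqThreeNotBPP)
open Summit.QuantumAdvantage.QuantumAdvantage.Theorems.IqThreeNotPPoly
  (stub_natAdapter card_filter_seeds encodeNat_mem_toLanguage_iff
    nil_not_mem_iqThreeLanguage not_isNegFundamentalDiscr_zero)

/-! ### The NO side (exact) -/

/-- **The filter**: `4k ∉ S` whenever `k` is not squarefree (`−4k ≢ 1 (mod 4)`, and the second
branch needs `−k` squarefree). [folklore] -/
theorem four_mul_not_mem_iqThreeSet {k : ℕ} (hk : ¬ Squarefree k) :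
    4 * k ∉ {d : ℕ | IsNegFundamentalDiscr d ∧ 3 ∣ BinaryQuadraticForm.classNumber (-(d : ℤ))} := by
  rintro ⟨hfund, -⟩
  rcases hfund with ⟨h1, -, -⟩ | ⟨-, -, h3⟩
  · omega
  · apply hk
    have e : (-((4 * k : ℕ) : ℤ)) / 4 = -(k : ℤ) := by push_cast; omega
    rw [e, ← Int.squarefree_natAbs, Int.natAbs_neg, Int.natAbs_natCast] at h3
    exact h3

/-- A non-squarefree `N` with `4 ∤ N` has a prime `p` with `p² ∣ M`, `M = N/2` resp. `N`. [folklore] -/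
theorem exists_prime_sq_dvd_half {N : ℕ} (hN : ¬ Squarefree N) (h4 : ¬ N % 4 = 0) :
    ∃ p : ℕ, p.Prime ∧ p * p ∣ (if N % 2 = 0 then N / 2 else N) := by
  obtain ⟨p, hp, hpp⟩ : ∃ p, Nat.Prime p ∧ p * p ∣ N := by
    by_contra h
    push Not at h
    exact hN (Nat.squarefree_iff_prime_squarefree.2 h)
  have hp2 : p ≠ 2 := by
    rintro rfl
    omega
  refine ⟨p, hp, ?_⟩
  split_ifs with h2
  · have hN2 : N = (N / 2) * 2 := by omega
    have hcop : Nat.Coprime (p * p) 2 :=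
      Nat.Coprime.mul_left ((Nat.coprime_primes hp Nat.prime_two).2 hp2)
        ((Nat.coprime_primes hp Nat.prime_two).2 hp2)
    rw [hN2] at hpp
    exact hcop.dvd_of_dvd_mul_right hpp
  · exact hpp

/-- **NO side (exact)**: a non-squarefree `N` never yields a member of `S`, for every length
parameter and every seed (the planted output, written out). [folklore] -/
theorem planted_not_mem_of_not_squarefree {N : ℕ} (hN : ¬ Squarefree N) (n j : ℕ) :
    (let M := if N % 2 = 0 then N / 2 else N
     let U := if M % 3 = 2 then 6 * M * 2 ^ (3 * n + 32) - 1 else 6 * M * 2 ^ (3 * n + 32) + 1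
     let s := 1 + 6 * M * U * j
     if N % 4 = 0 then 0 else 4 * (M * s * (2 * U ^ 3 - M * s))) ∉
      {d : ℕ | IsNegFundamentalDiscr d ∧ 3 ∣ BinaryQuadraticForm.classNumber (-(d : ℤ))} := by
  dsimp only
  by_cases h4 : N % 4 = 0
  · rw [if_pos h4]
    exact fun h => not_isNegFundamentalDiscr_zero h.1
  · rw [if_neg h4]
    apply four_mul_not_mem_iqThreeSet
    obtain ⟨p, hp, hpM⟩ := exists_prime_sq_dvd_half hN h4
    intro hsq
    exact hp.one_lt.ne' (Nat.isUnit_iff.1 (hsq p ((hpM.mul_right _).mul_right _)))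

/-! ### The YES side bookkeeping -/

/-- A squarefree `N` has `4 ∤ N`. [folklore] -/
theorem not_four_dvd_of_squarefree {N : ℕ} (hN : Squarefree N) : ¬ N % 4 = 0 := by
  intro h4
  have h := Nat.isUnit_iff.1 (hN 2 (by omega))
  omega

/-- For squarefree `N`: `M = N/2` (if `N` even) resp. `N` is odd and squarefree. [folklore] -/
theorem odd_and_squarefree_half {N : ℕ} (hN : Squarefree N) :
    Odd (if N % 2 = 0 then N / 2 else N) ∧ Squarefree (if N % 2 = 0 then N / 2 else N) := by
  have h4 := not_four_dvd_of_squarefree hN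
  split_ifs with h2
  · refine ⟨?_, ?_⟩
    · rw [Nat.odd_iff]; omega
    · exact hN.squarefree_of_dvd ⟨2, by omega⟩
  · exact ⟨Nat.odd_iff.2 (by omega), hN⟩

/-! ### The domination -/

/-- **`IQ3 ∈ BPP → SQUAREFREES ∈ BPP`**, class-field-theory-free: the planted sampler
`stub_samplerCubeFP` guarded by the landed `stub_natAdapter`, exact NO side
`planted_not_mem_of_not_squarefree`, YES-density `≥ 1/4` by the density stub, hits certified by
`stub_cubeHit ∘ stub_orderThreeCert`, fed to the uniform closure `stub_rurClosureBPP` with seed length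
`ℓ(n) = 6n + 60` and success polynomial `4`. [cite: AroraBarakCC2009, §7.6] -/
theorem toLanguage_squarefree_mem_BPP_of_iqThree
    (hIQ : encodingNatBool.toLanguage
      {d : ℕ | IsNegFundamentalDiscr d ∧ 3 ∣ BinaryQuadraticForm.classNumber (-(d : ℤ))} ∈ BPP) :
    encodingNatBool.toLanguage {m : ℕ | Squarefree m} ∈ BPP := by
  obtain ⟨f, hf, hfval⟩ := stub_samplerCubeFP
  obtain ⟨f', hf', hcanon, hjunk⟩ := stub_natAdapter f hf []
  obtain ⟨n₀, hdens⟩ := stub_cubeDensity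
  refine stub_rurClosureBPP (encodingNatBool.toLanguage {m : ℕ | Squarefree m})
    (encodingNatBool.toLanguage
      {d : ℕ | IsNegFundamentalDiscr d ∧ 3 ∣ BinaryQuadraticForm.classNumber (-(d : ℤ))})
    f' hf' (fun n => 6 * n + 60) (6 * X + 60) 4 n₀
    (fun n => by simp) ?_ ?_ hIQ
  · -- NO side (exact): non-squarefree numerals by the filter, non-numerals by the guard
    intro x hx r
    by_cases hcx : ∃ m : ℕ, encodeNat m = x
    · obtain ⟨m, rfl⟩ := hcx
      have hm : ¬ Squarefree m := fun h =>
        hx ((encodeNat_mem_toLanguage_iff {m : ℕ | Squarefree m} m).2 h)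
      rw [hcanon, hfval, bitsToNat_encodeNat, encodeNat_mem_toLanguage_iff]
      exact planted_not_mem_of_not_squarefree hm (encodeNat m).length (bitsToNat r)
    · rw [hjunk x r (fun m hm => hcx ⟨m, hm⟩)]
      exact nil_not_mem_iqThreeLanguage
  · -- YES side (density ≥ 1/4): good seeds give members of `S`
    intro x hx hn
    obtain ⟨N, hN, hNx⟩ := hx
    change encodeNat N = x at hNx
    subst hNx
    have hsq : Squarefree N := hN
    have h4 : ¬ N % 4 = 0 := not_four_dvd_of_squarefree hsq
    have hNlt : N < 2 ^ (encodeNat N).length := by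
      have h := bitsToNat_lt (encodeNat N)
      rwa [bitsToNat_encodeNat] at h
    set M : ℕ := (if N % 2 = 0 then N / 2 else N) with hM
    obtain ⟨hModd, hMsq⟩ := odd_and_squarefree_half hsq
    rw [← hM] at hModd hMsq
    have hMle : M ≤ N := by rw [hM]; split_ifs <;> omega
    have hMlt : M < 2 ^ (encodeNat N).length := lt_of_le_of_lt hMle hNlt
    set U : ℕ := (if M % 3 = 2 then 6 * M * 2 ^ (3 * (encodeNat N).length + 32) - 1
      else 6 * M * 2 ^ (3 * (encodeNat N).length + 32) + 1) with hU
    have hd := hdens (encodeNat N).length hn M hModd hMlt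
    dsimp only at hd
    rw [← hU] at hd
    have hq : (4 : Polynomial ℕ).eval (encodeNat N).length = 4 := by simp
    rw [hq]
    refine hd.trans (Nat.mul_le_mul_left _ ?_)
    have e : ((Finset.range (2 ^ (6 * (encodeNat N).length + 60))).filter (fun j =>
        M * (1 + 6 * M * U * j) ≤ U ^ 3 ∧ Squarefree (1 + 6 * M * U * j) ∧
          Squarefree (2 * U ^ 3 - M * (1 + 6 * M * U * j)))).card =
        (univ.filter (fun r : Fin (6 * (encodeNat N).length + 60) → Bool =>
          M * (1 + 6 * M * U * bitsToNat (List.ofFn r)) ≤ U ^ 3 ∧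
            Squarefree (1 + 6 * M * U * bitsToNat (List.ofFn r)) ∧
            Squarefree (2 * U ^ 3 - M * (1 + 6 * M * U * bitsToNat (List.ofFn r))))).card := by
      convert (card_filter_seeds (6 * (encodeNat N).length + 60) (fun j =>
        M * (1 + 6 * M * U * j) ≤ U ^ 3 ∧ Squarefree (1 + 6 * M * U * j) ∧
          Squarefree (2 * U ^ 3 - M * (1 + 6 * M * U * j)))).symm using 3
    refine le_of_eq_of_le e (Finset.card_le_card fun r hr => ?_)
    rw [Finset.mem_filter] at hr ⊢
    refine ⟨Finset.mem_univ _, ?_⟩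
    obtain ⟨hle, hs, hw⟩ := hr.2
    rw [hcanon, hfval, bitsToNat_encodeNat, encodeNat_mem_toLanguage_iff]
    have hhit := stub_cubeHit stub_orderThreeCert (encodeNat N).length M
      (bitsToNat (List.ofFn r)) hModd hMsq
    dsimp only at hhit
    rw [← hU] at hhit
    have hhit' := hhit hle hs hw
    dsimp only
    rw [← hM, ← hU, if_neg h4]
    exact hhit'

/-! ### The crux by name, and the refutation floor -/

/-- **The crux from the apex, unconditionally: `SQUAREFREES ∉ BPP → IqThreeNotBPP`.** CONDITIONAL
theorem on the route decl, by name, with the single hypothesis "squarefreeness testing is not in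
`BPP`" (hypothesis-type — Adleman–McCurley's open problem in the uniform setting; it implies
`FACTORING ∉ FP`). No named fact, no class field theory. [cite: AroraBarakCC2009, §7.6] -/
theorem iqThreeNotBPP_of_squarefree_not_mem_BPP
    (hSQF : encodingNatBool.toLanguage {m : ℕ | Squarefree m} ∉ BPP) : IqThreeNotBPP :=
  fun hIQ => hSQF (toLanguage_squarefree_mem_BPP_of_iqThree hIQ)

/-- **The refutation floor**: a refutation of the crux (a `BPP` algorithm deciding `3 ∣ h(−d)` on
fundamental `−d`) yields a `BPP` algorithm for SQUAREFREENESS — uniformly, no advice,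
unconditionally. [cite: AroraBarakCC2009, §7.6] -/
theorem toLanguage_squarefree_mem_BPP_of_not_iqThreeNotBPP (h : ¬ IqThreeNotBPP) :
    encodingNatBool.toLanguage {m : ℕ | Squarefree m} ∈ BPP :=
  toLanguage_squarefree_mem_BPP_of_iqThree (not_not.1 h)

end Summit.QuantumAdvantage.QuantumAdvantage.Theorems.IqThreeNotBPP

end
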